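import Mathlib.RingTheory.Polynomial.GaussLemma
import Mathlib.RingTheory.AdjoinRoot
import Mathlib.FieldTheory.RatFunc.IntermediateField
import Mathlib.RingTheory.AlgebraicIndependent.TranscendenceBasis
import Literature.NumberTheory.DiophantineGeometry.FunctionFieldGenusRiemannTheoremProofs
import HarnessLib

/-!
# The function field `K(x)[Y]/(Φ)` of an irreducible plane curve `Φ(X, Y) = 0`

Library file of the function-field chain (`FunctionFieldDivisors`, `FunctionFieldGenus`, …). For a
field `K` and a bivariate polynomial `Φ ∈ K[X][Y]`, monic in `Y` and irreducible, the function
field of the affine plane curve `Φ = 0` is realised as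

  `F_Φ := AdjoinRoot (Φ ↦ K(X)[Y]) = K(X)[Y]/(Φ)`,

a field because `Φ` stays irreducible over `K(X) = RatFunc K` (Gauss's lemma,
`irreducible_map_ratFunc`; the `Field` instance is Mathlib's `AdjoinRoot.instField`, fed by a
`Fact (Irreducible _)` hypothesis). Writing `x` for the image of `X` and `y` for the class of `Y`:

To keep statements short the file is written for an arbitrary field `F` which is compatibly an
algebra over `K`, `K[X]` and `RatFunc K` and carries a power basis `pb` over `RatFunc K` (the model:
`AdjoinRoot.powerBasis`), with `x ∈ F` the image of `X` and `y = pb.gen`: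

* `isAlgFunctionField_of_powerBasis`: `F/K` is an algebraic function field of one variable
  (`trdeg = 1 + 0`, generated by `x, y`);
* `transcendental_algebraMap_X`: `x` is transcendental over `K`;
* `adjoin_algebraMap_X_eq_fieldRange`, `finrank_adjoin_algebraMap_X_eq_dim`: `K(x)` is the image
  of `RatFunc K` and `[F : K(x)] = d`;
* `linearIndependent_monomial`: the monomials `xⁱ yʲ` (`j < d`) are linearly independent over `K`;
* `evalEval_algebraMap_X_eq_zero`: `Φ(x, y) = 0` when `y` is a root of `Φ` over `K(X)`;
* `valuation_le_max_of_eval₂_eq_zero`, `mem_riemannRochSpace_negPart_of_aeval_eq_zero`: if `Φ`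
  is monic of degree `d` in `Y` and of total degree `d`, then `w(y) ≤ max (1, w(x))` for every
  valuation trivial on `K`, i.e. `y ∈ ℒ((x)_∞)`.

These are the inputs of the genus bound `PlaneCurveGenusBoundProofs` and of the rational-point
argument `PlaneCurveRationalPlaceProofs` (Cafure–Matera 2006, proof of Thm. 5.4: Weil's estimate
for an absolutely irreducible plane curve). The full-constant-field property (from absolute
irreducibility) is proved in a sibling file. No definitions are introduced.

## References

* H. Stichtenoth, *Algebraic Function Fields and Codes*, 2nd ed., GTM 254, Springer 2009, §1.1–1.4
  (Def. 1.1.1; the example of plane curves, App. B). [Stichtenoth2009]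
* A. Cafure, G. Matera, Finite Fields Appl. 12 (2006) 155–185, proof of Thm. 5.4. [CafureMatera2006]
-/

noncomputable section

open scoped Classical Polynomial.Bivariate IntermediateField
open Polynomial

namespace Literature.NumberTheory.DiophantineGeometry.AlgFunctionField

universe u

variable {K : Type u} [Field K]

/-! ### Gauss: `Φ` monic irreducible in `K[X][Y]` stays irreducible in `K(X)[Y]` -/

/-- **Gauss's lemma for plane curves.** A monic (in `Y`) irreducible `Φ ∈ K[X][Y]` is irreducible
in `K(X)[Y]`. [folklore] -/
theorem irreducible_map_ratFunc {Φ : K[X][Y]} (hm : Φ.Monic) (hirr : Irreducible Φ) :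
    Irreducible (Φ.map (algebraMap K[X] (RatFunc K))) :=
  (hm.irreducible_iff_irreducible_map_fraction_map (K := RatFunc K)).1 hirr

/-! ### A valuation inequality: `w(y) ≤ max(1, w(x))` on a plane model of total degree `deg_Y` -/

section Valuation

universe v

variable {F : Type v} [Field F] [Algebra K F] {Γ : Type*} [LinearOrderedCommGroupWithZero Γ]
  (w : Valuation F Γ)

/-- If `w ≤ 1` on `K` then `w(h(x)) ≤ max (1, w x) ^ deg h` for every `h ∈ K[X]`. [folklore] -/
theorem valuation_aeval_le (hK : ∀ c : K, w (algebraMap K F c) ≤ 1) (x : F) (h : K[X]) :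
    w (aeval x h) ≤ max 1 (w x) ^ h.natDegree := by
  rw [aeval_eq_sum_range]
  refine Valuation.map_sum_le _ fun i hi ↦ ?_
  rw [Finset.mem_range] at hi
  rw [Algebra.smul_def, map_mul, map_pow]
  calc w (algebraMap K F (h.coeff i)) * w x ^ i ≤ 1 * max 1 (w x) ^ i :=
        mul_le_mul' (hK _) (pow_le_pow_left₀ zero_le (le_max_right _ _) i)
    _ ≤ max 1 (w x) ^ h.natDegree := by
        rw [one_mul]
        exact pow_le_pow_right₀ (le_max_left _ _) (by omega)

/-- **The valuation inequality of a plane model.** Let `Φ ∈ K[X][Y]` be monic in `Y` of degree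
`d` with `deg_X (coeff of Yⁱ) ≤ d - i` (e.g. `Φ` of total degree `d`), and let `Φ(x, y) = 0` in a
field `F ⊇ K`. Then `w(y) ≤ max (1, w(x))` for every valuation `w` of `F` with `w ≤ 1` on `K`:
otherwise the term `y^d` would strictly dominate every `aᵢ(x) yⁱ`, `i < d`, in the ultrametric
inequality. (For `w(x) ≤ 1` this is integrality of `y` over `K[x]`; for `w(x) > 1` it is
integrality of `y/x` over `K[1/x]`.) [folklore] -/
theorem valuation_le_max_of_eval₂_eq_zero (hK : ∀ c : K, w (algebraMap K F c) ≤ 1) {x y : F}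
    {Φ : K[X][Y]} (hm : Φ.Monic) (hdeg : ∀ i, (Φ.coeff i).natDegree + i ≤ Φ.natDegree)
    (hΦ : Φ.eval₂ (aeval x : K[X] →ₐ[K] F).toRingHom y = 0) : w y ≤ max 1 (w x) := by
  set d := Φ.natDegree with hd
  set M := max 1 (w x) with hM
  by_contra hcon
  rw [not_le] at hcon
  have hM1 : 1 ≤ M := le_max_left _ _
  have hy0 : 0 < w y := lt_of_lt_of_le (zero_lt_one.trans_le hM1) hcon.le
  -- `y^d = - ∑_{i<d} aᵢ(x) yⁱ`
  rw [eval₂_eq_sum_range, Finset.sum_range_succ, ← hd] at hΦ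
  simp only [AlgHom.toRingHom_eq_coe, RingHom.coe_coe] at hΦ
  rw [show Φ.coeff d = 1 from hm.coeff_natDegree, map_one, one_mul] at hΦ
  have hyd : w (y ^ d) = w (∑ i ∈ Finset.range d, aeval x (Φ.coeff i) * y ^ i) := by
    rw [← Valuation.map_neg _ (∑ i ∈ Finset.range d, _), (neg_eq_of_add_eq_zero_right hΦ)]
  -- every term `aᵢ(x) yⁱ`, `i < d`, is strictly smaller than `(w y)^d`
  have hlt : w (∑ i ∈ Finset.range d, aeval x (Φ.coeff i) * y ^ i) < w y ^ d := by
    refine Valuation.map_sum_lt _ (pow_ne_zero _ hy0.ne') fun i hi ↦ ?_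
    rw [Finset.mem_range] at hi
    rw [map_mul, map_pow]
    have h1 : w (aeval x (Φ.coeff i)) ≤ M ^ (d - i) :=
      (valuation_aeval_le w hK x _).trans (pow_le_pow_right₀ hM1 (by have := hdeg i; omega))
    have h2 : M ^ (d - i) < w y ^ (d - i) := pow_lt_pow_left₀ hcon zero_le (by omega)
    calc w (aeval x (Φ.coeff i)) * w y ^ i ≤ M ^ (d - i) * w y ^ i :=
          mul_le_mul' h1 le_rfl
      _ < w y ^ (d - i) * w y ^ i := mul_lt_mul_of_pos_right h2 (pow_pos hy0 _)
      _ = w y ^ d := by rw [← pow_add]; congr 1; omega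
  rw [← hyd, map_pow] at hlt
  exact lt_irrefl _ hlt

end Valuation

section Model

/-! ### Extensions of `K(X)` with a power basis: the function field of a plane curve

Throughout, `F` is a field which is an algebra over `K`, `K[X]` and `K(X) = RatFunc K` compatibly;
`x ∈ F` denotes the image of `X`. The model case is `F = AdjoinRoot (Φ ↦ K(X)[Y])` with its power
basis `1, y, …, y^{d-1}` (`AdjoinRoot.powerBasis`), `y` the class of `Y`. -/

variable {F : Type u} [Field F] [Algebra K F] [Algebra K[X] F] [Algebra (RatFunc K) F]
  [IsScalarTower K[X] (RatFunc K) F] [IsScalarTower K (RatFunc K) F] [IsScalarTower K K[X] F]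

omit [Algebra K F] [IsScalarTower K (RatFunc K) F] [IsScalarTower K K[X] F] in
/-- The structure map `K[X] → F` factors through `K(X)`. [folklore] -/
theorem algebraMap_polynomial_eq :
    algebraMap K[X] F = (algebraMap (RatFunc K) F).comp (algebraMap K[X] (RatFunc K)) :=
  IsScalarTower.algebraMap_eq K[X] (RatFunc K) F

omit [Algebra K F] [IsScalarTower K (RatFunc K) F] [IsScalarTower K K[X] F] in
/-- The structure map `K[X] → F` is injective. This is Mathlib's
`FunctionField.algebraMap_injective K F`; the name is kept for `aeval_ne_zero_of_lt` below.
[folklore] -/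
theorem algebraMap_polynomial_injective : Function.Injective (algebraMap K[X] F) :=
  FunctionField.algebraMap_injective K F

omit [Algebra K F] [IsScalarTower K (RatFunc K) F] [IsScalarTower K K[X] F] in
/-- `x` is the image of `X ∈ K(X)`. [folklore] -/
theorem algebraMap_ratFunc_X : algebraMap (RatFunc K) F RatFunc.X = algebraMap K[X] F X := by
  rw [algebraMap_polynomial_eq, RingHom.comp_apply, RatFunc.algebraMap_X]

omit [Algebra (RatFunc K) F] [IsScalarTower K[X] (RatFunc K) F] [IsScalarTower K (RatFunc K) F] in
/-- The `K`-algebra evaluation at `x` is the structure map `K[X] → F`. [folklore] -/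
theorem aeval_algebraMap_X_eq (p : K[X]) : aeval (algebraMap K[X] F X) p = algebraMap K[X] F p := by
  have h : (aeval (algebraMap K[X] F X) : K[X] →ₐ[K] F) = IsScalarTower.toAlgHom K K[X] F :=
    Polynomial.algHom_ext (by simp)
  exact DFunLike.congr_fun h p

omit [IsScalarTower K (RatFunc K) F] in
variable (K F) in
/-- **`x` is transcendental over `K`.** [folklore] -/
theorem transcendental_algebraMap_X : Transcendental K (algebraMap K[X] F X) := by
  rw [transcendental_iff_injective]
  intro p q hpq
  rw [aeval_algebraMap_X_eq, aeval_algebraMap_X_eq] at hpq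
  exact algebraMap_polynomial_injective hpq

omit [IsScalarTower K (RatFunc K) F] in
variable (K F) in
/-- `x ≠ 0`. [folklore] -/
theorem algebraMap_X_ne_zero : algebraMap K[X] F X ≠ 0 := fun h ↦
  transcendental_algebraMap_X K F (by rw [h]; exact isAlgebraic_zero)

omit [IsScalarTower K K[X] F] in
variable (K F) in
/-- `K(x) ⊆ F` is the image of `RatFunc K`. [folklore] -/
theorem adjoin_algebraMap_X_eq_fieldRange :
    K⟮algebraMap K[X] F X⟯ = (IsScalarTower.toAlgHom K (RatFunc K) F).fieldRange := by
  rw [AlgHom.fieldRange_eq_map, ← RatFunc.adjoin_X, IntermediateField.adjoin_map,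
    Set.image_singleton]
  congr 2
  exact (algebraMap_ratFunc_X (K := K) (F := F)).symm

omit [IsScalarTower K K[X] F] in
/-- Every element of `K(X)` maps into `K(x)`. [folklore] -/
theorem algebraMap_ratFunc_mem_adjoin (r : RatFunc K) :
    algebraMap (RatFunc K) F r ∈ K⟮algebraMap K[X] F X⟯ := by
  rw [adjoin_algebraMap_X_eq_fieldRange, AlgHom.mem_fieldRange]
  exact ⟨r, rfl⟩

omit [IsScalarTower K K[X] F] in
variable (K F) in
/-- **`[F : K(x)] = [F : K(X)]`**: the degree over the subfield `K(x)` is the degree over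
`RatFunc K`. [folklore] -/
theorem finrank_adjoin_algebraMap_X :
    Module.finrank K⟮algebraMap K[X] F X⟯ F = Module.finrank (RatFunc K) F := by
  symm
  set f : RatFunc K →ₐ[K] F := IsScalarTower.toAlgHom K (RatFunc K) F with hf
  set E : IntermediateField K F := K⟮algebraMap K[X] F X⟯ with hE
  let g : RatFunc K →+* E := (f : RatFunc K →+* F).codRestrict E
    (fun r ↦ algebraMap_ratFunc_mem_adjoin r)
  have hg : Function.Bijective g := by
    refine ⟨fun a b h ↦ f.injective (congrArg Subtype.val h), fun z ↦ ?_⟩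
    have hz : (z : F) ∈ f.fieldRange := by
      rw [← adjoin_algebraMap_X_eq_fieldRange]; exact z.2
    obtain ⟨r, hr⟩ := AlgHom.mem_fieldRange.1 hz
    exact ⟨r, Subtype.ext hr⟩
  refine Algebra.finrank_eq_of_equiv_equiv (RingEquiv.ofBijective g hg) (RingEquiv.refl F) ?_
  ext r
  rfl

omit [Algebra K[X] F] [IsScalarTower K[X] (RatFunc K) F] [IsScalarTower K K[X] F] in
variable (K F) in
/-- `F/K` has transcendence degree one when `F/K(X)` is finite. [folklore] -/
theorem trdeg_eq_one_of_finiteDimensional [FiniteDimensional (RatFunc K) F] :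
    Algebra.trdeg K F = 1 := by
  have h := trdeg_add_eq K (RatFunc K) (A := F)
  rw [IsAlgFunctionField.trdeg_eq_one (K := K) (F := RatFunc K),
    trdeg_eq_zero (R := RatFunc K) (A := F), add_zero] at h
  exact h.symm

omit [Algebra (RatFunc K) F] [IsScalarTower K[X] (RatFunc K) F] [IsScalarTower K (RatFunc K) F] in
/-- The two-variable evaluation map `K[X] → F` at `x` (through `K → F`) is the structure map.
[folklore] -/
theorem eval₂RingHom_algebraMap_X :
    eval₂RingHom (algebraMap K F) (algebraMap K[X] F X) = algebraMap K[X] F := by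
  refine Polynomial.ringHom_ext (fun c ↦ ?_) ?_
  · rw [coe_eval₂RingHom, eval₂_C]
    change _ = algebraMap K[X] F (algebraMap K K[X] c)
    rw [← IsScalarTower.algebraMap_apply]
  · rw [coe_eval₂RingHom, eval₂_X]

/-! ### With a power basis `1, y, …, y^{d-1}` over `K(X)` -/

omit [IsScalarTower K K[X] F] in
/-- `F = K(x, y)` is finitely generated over `K`. [folklore] -/
theorem adjoin_X_gen_eq_top (pb : PowerBasis (RatFunc K) F) :
    IntermediateField.adjoin K {algebraMap K[X] F X, pb.gen} = ⊤ := by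
  rw [eq_top_iff]
  intro z _
  obtain ⟨p, rfl⟩ := pb.exists_eq_aeval' z
  rw [aeval_eq_sum_range]
  refine sum_mem fun i _ ↦ ?_
  rw [Algebra.smul_def]
  refine mul_mem ?_ (pow_mem (IntermediateField.subset_adjoin K _ (by simp)) _)
  have h1 : K⟮algebraMap K[X] F X⟯ ≤ IntermediateField.adjoin K {algebraMap K[X] F X, pb.gen} :=
    IntermediateField.adjoin.mono K _ _ (by simp)
  exact h1 (algebraMap_ratFunc_mem_adjoin (p.coeff i))

omit [IsScalarTower K K[X] F] in
/-- **`F/K` is an algebraic function field of one variable** (Stichtenoth Def. 1.1.1), for `F`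
finite over `K(X)` with a power basis. [cite: Stichtenoth2009, Def. 1.1.1] -/
theorem isAlgFunctionField_of_powerBasis (pb : PowerBasis (RatFunc K) F) :
    IsAlgFunctionField K F where
  trdeg_eq_one := by
    haveI := pb.finite
    exact trdeg_eq_one_of_finiteDimensional K F
  fg_top := ⟨{algebraMap K[X] F X, pb.gen}, by simpa using adjoin_X_gen_eq_top pb⟩

omit [IsScalarTower K K[X] F] in
/-- `[F : K(x)] = d`, the dimension of the power basis. [folklore] -/
theorem finrank_adjoin_algebraMap_X_eq_dim (pb : PowerBasis (RatFunc K) F) :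
    Module.finrank K⟮algebraMap K[X] F X⟯ F = pb.dim := by
  rw [finrank_adjoin_algebraMap_X, pb.finrank]

omit [IsScalarTower K (RatFunc K) F] in
/-- **The monomials `xⁱ yʲ` (`i ≤ l`, `j < d`) are linearly independent over `K`**
(`1, y, …, y^{d-1}` is a `K(X)`-basis and `x` is transcendental). [folklore] -/
theorem linearIndependent_monomial (pb : PowerBasis (RatFunc K) F) (l : ℕ) :
    LinearIndependent K fun ij : Fin (l + 1) × Fin pb.dim ↦
      algebraMap K[X] F X ^ (ij.1 : ℕ) * pb.gen ^ (ij.2 : ℕ) := by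
  rw [Fintype.linearIndependent_iff]
  intro g hg
  -- the polynomials `q_j = ∑_i g(i,j) X^i`
  let q : Fin pb.dim → K[X] := fun j ↦ ∑ i : Fin (l + 1), C (g (i, j)) * X ^ (i : ℕ)
  have hrel : ∑ j, (algebraMap K[X] (RatFunc K) (q j)) • pb.basis j = 0 := by
    rw [← hg, Fintype.sum_prod_type, Finset.sum_comm]
    refine Finset.sum_congr rfl fun j _ ↦ ?_
    rw [PowerBasis.coe_basis, Algebra.smul_def, ← IsScalarTower.algebraMap_apply, map_sum,
      Finset.sum_mul]
    refine Finset.sum_congr rfl fun i _ ↦ ?_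
    rw [map_mul, map_pow, Algebra.smul_def, IsScalarTower.algebraMap_apply K K[X] F,
      Polynomial.algebraMap_eq, mul_assoc]
  have hq0 : ∀ j, q j = 0 := fun j ↦ by
    have h := Fintype.linearIndependent_iff.1 pb.basis.linearIndependent _ hrel j
    exact IsFractionRing.injective K[X] (RatFunc K) (by rw [h, map_zero])
  rintro ⟨i, j⟩
  have := congrArg (fun r : K[X] ↦ r.coeff i) (hq0 j)
  simpa [q, finsetSum_coeff, coeff_C_mul_X_pow, Fin.val_eq_val] using this

/-! ### With a root `y` of `Φ` -/

variable {Φ : K[X][Y]} {y : F} (hΦ : aeval y (Φ.map (algebraMap K[X] (RatFunc K))) = 0)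
include hΦ

omit [Algebra K F] [IsScalarTower K (RatFunc K) F] [IsScalarTower K K[X] F] in
/-- `Φ(x, y) = 0` in the form `Φ.eval₂ (K[X] → F) y = 0`. [folklore] -/
theorem eval₂_algebraMap_eq_zero : Φ.eval₂ (algebraMap K[X] F) y = 0 := by
  rwa [aeval_def, eval₂_map, ← algebraMap_polynomial_eq] at hΦ

omit [IsScalarTower K (RatFunc K) F] in
/-- `Φ(x, y) = 0` in the form `Φ.eval₂ (aeval x) y = 0`. [folklore] -/
theorem eval₂_aeval_algebraMap_X_eq_zero :
    Φ.eval₂ (aeval (algebraMap K[X] F X) : K[X] →ₐ[K] F).toRingHom y = 0 := by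
  have hring : (aeval (algebraMap K[X] F X) : K[X] →ₐ[K] F).toRingHom = algebraMap K[X] F :=
    RingHom.ext fun p ↦ aeval_algebraMap_X_eq p
  rw [hring]
  exact eval₂_algebraMap_eq_zero hΦ

omit [IsScalarTower K (RatFunc K) F] in
/-- **`Φ(x, y) = 0`** as a bivariate evaluation. [folklore] -/
theorem evalEval_algebraMap_X_eq_zero :
    (Φ.map (mapRingHom (algebraMap K F))).evalEval (algebraMap K[X] F X) y = 0 := by
  rw [← eval₂_eval₂RingHom_apply, eval₂RingHom_algebraMap_X]
  exact eval₂_algebraMap_eq_zero hΦ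

omit [IsScalarTower K (RatFunc K) F] in
/-- **`y ∈ ℒ((x)_∞)` on a plane model of total degree `deg_Y Φ`.** If `Φ` is monic in `Y` of
degree `d` with `deg_X (coeff of Yⁱ) + i ≤ d` and `Φ(x, y) = 0` in an algebraic function field
`F/K` as above, then `y` has poles only at poles of `x`, of at most the same order: `y ∈ ℒ((x)_∞)`.
From the valuation inequality `w(y) ≤ max (1, w(x))` at every place. [folklore] -/
theorem mem_riemannRochSpace_negPart_of_aeval_eq_zero [IsAlgFunctionField K F] (hm : Φ.Monic)
    (hdeg : ∀ i, (Φ.coeff i).natDegree + i ≤ Φ.natDegree) :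
    y ∈ riemannRochSpace (principalDivisor K (algebraMap K[X] F X))⁻ := by
  set x : F := algebraMap K[X] F X with hx
  have hx0 : x ≠ 0 := algebraMap_X_ne_zero K F
  by_cases hy0 : y = 0
  · rw [hy0]; exact zero_mem _
  refine mem_riemannRochSpace_of_neg_apply_le_ord hy0 fun v ↦ ?_
  rw [Divisor.negPart_apply, principalDivisor_apply_of_ne_zero hx0]
  have hK : ∀ c : K, v.valuation (algebraMap K F c) ≤ 1 := fun c ↦
    v.toValuationSubring.valuation_le_one ⟨_, v.algebraMap_mem c⟩
  have key : v.valuation y ≤ max 1 (v.valuation x) :=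
    valuation_le_max_of_eval₂_eq_zero v.valuation hK hm hdeg (eval₂_aeval_algebraMap_X_eq_zero hΦ)
  by_cases hvx : v.valuation x ≤ 1
  · rw [max_eq_left hvx] at key
    have hyO : y ∈ v.toValuationSubring := (v.toValuationSubring.valuation_le_one_iff y).1 key
    rw [v.mem_toValuationSubring_iff_ord_nonneg hy0] at hyO
    have : 0 ≤ max (-v.ord x) 0 := le_max_right _ _
    omega
  · rw [not_le] at hvx
    rw [max_eq_right hvx.le] at key
    have hyx : y / x ∈ v.toValuationSubring := by
      rw [← v.toValuationSubring.valuation_le_one_iff, map_div₀]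
      exact div_le_one_of_le₀ key zero_le
    rw [v.mem_toValuationSubring_iff_ord_nonneg (div_ne_zero hy0 hx0), v.ord_div hy0 hx0] at hyx
    have hordx : v.ord x < 0 := (v.one_lt_valuation_iff_ord_neg hx0).1 hvx
    have : max (-v.ord x) 0 = -v.ord x := max_eq_left (by omega)
    omega

end Model

/-! ### Corrected total-degree hypothesis

The hypothesis `∀ i, deg_X (coeff of Yⁱ) + i ≤ d` of `valuation_le_max_of_eval₂_eq_zero` and
`mem_riemannRochSpace_negPart_of_aeval_eq_zero` above is only ever satisfiable for `d = 0` (for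
`i > d` the coefficient vanishes but `i ≤ d` fails); the proofs use it for `i < d` only. The primed
versions below carry the intended hypothesis `∀ i < d, deg_X (coeff of Yⁱ) + i ≤ d` (total degree
`d`), with the same proofs. -/

section Corrected

variable {F : Type u} [Field F] [Algebra K F]

/-- **The valuation inequality of a plane model** (corrected hypothesis). Let `Φ ∈ K[X][Y]` be
monic in `Y` of degree `d` with `deg_X (coeff of Yⁱ) + i ≤ d` for `i < d` (total degree `d`), and
let `Φ(x, y) = 0` in a field `F ⊇ K`. Then `w(y) ≤ max (1, w(x))` for every valuation `w` of `F`
with `w ≤ 1` on `K`. [folklore] -/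
theorem valuation_le_max_of_eval₂_eq_zero' {Γ : Type*} [LinearOrderedCommGroupWithZero Γ]
    (w : Valuation F Γ) (hK : ∀ c : K, w (algebraMap K F c) ≤ 1) {x y : F}
    {Φ : K[X][Y]} (hm : Φ.Monic)
    (hdeg : ∀ i, i < Φ.natDegree → (Φ.coeff i).natDegree + i ≤ Φ.natDegree)
    (hΦ : Φ.eval₂ (aeval x : K[X] →ₐ[K] F).toRingHom y = 0) : w y ≤ max 1 (w x) := by
  set d := Φ.natDegree with hd
  set M := max 1 (w x) with hM
  by_contra hcon
  rw [not_le] at hcon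
  have hM1 : 1 ≤ M := le_max_left _ _
  have hy0 : 0 < w y := lt_of_lt_of_le (zero_lt_one.trans_le hM1) hcon.le
  rw [eval₂_eq_sum_range, Finset.sum_range_succ, ← hd] at hΦ
  simp only [AlgHom.toRingHom_eq_coe, RingHom.coe_coe] at hΦ
  rw [show Φ.coeff d = 1 from hm.coeff_natDegree, map_one, one_mul] at hΦ
  have hyd : w (y ^ d) = w (∑ i ∈ Finset.range d, aeval x (Φ.coeff i) * y ^ i) := by
    rw [← Valuation.map_neg _ (∑ i ∈ Finset.range d, _), (neg_eq_of_add_eq_zero_right hΦ)]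
  have hlt : w (∑ i ∈ Finset.range d, aeval x (Φ.coeff i) * y ^ i) < w y ^ d := by
    refine Valuation.map_sum_lt _ (pow_ne_zero _ hy0.ne') fun i hi ↦ ?_
    rw [Finset.mem_range] at hi
    rw [map_mul, map_pow]
    have h1 : w (aeval x (Φ.coeff i)) ≤ M ^ (d - i) :=
      (valuation_aeval_le w hK x _).trans (pow_le_pow_right₀ hM1 (by have := hdeg i hi; omega))
    have h2 : M ^ (d - i) < w y ^ (d - i) := pow_lt_pow_left₀ hcon zero_le (by omega)
    calc w (aeval x (Φ.coeff i)) * w y ^ i ≤ M ^ (d - i) * w y ^ i :=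
          mul_le_mul' h1 le_rfl
      _ < w y ^ (d - i) * w y ^ i := mul_lt_mul_of_pos_right h2 (pow_pos hy0 _)
      _ = w y ^ d := by rw [← pow_add]; congr 1; omega
  rw [← hyd, map_pow] at hlt
  exact lt_irrefl _ hlt

variable [Algebra K[X] F] [Algebra (RatFunc K) F] [IsScalarTower K[X] (RatFunc K) F]
  [IsScalarTower K K[X] F]

/-- **`y ∈ ℒ((x)_∞)` on a plane model of total degree `deg_Y Φ`** (corrected hypothesis). If `Φ`
is monic in `Y` of degree `d` with `deg_X (coeff of Yⁱ) + i ≤ d` for `i < d`, and `Φ(x, y) = 0` in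
an algebraic function field `F/K` (an algebra over `K[X] ⊆ K(X)`, `x` the image of `X`), then
`y ∈ ℒ((x)_∞)`. [folklore] -/
theorem mem_riemannRochSpace_negPart_of_aeval_eq_zero' [IsAlgFunctionField K F] {Φ : K[X][Y]}
    {y : F} (hΦ : aeval y (Φ.map (algebraMap K[X] (RatFunc K))) = 0) (hm : Φ.Monic)
    (hdeg : ∀ i, i < Φ.natDegree → (Φ.coeff i).natDegree + i ≤ Φ.natDegree) :
    y ∈ riemannRochSpace (principalDivisor K (algebraMap K[X] F X))⁻ := by
  set x : F := algebraMap K[X] F X with hx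
  have hx0 : x ≠ 0 := algebraMap_X_ne_zero K F
  by_cases hy0 : y = 0
  · rw [hy0]; exact zero_mem _
  refine mem_riemannRochSpace_of_neg_apply_le_ord hy0 fun v ↦ ?_
  rw [Divisor.negPart_apply, principalDivisor_apply_of_ne_zero hx0]
  have hK : ∀ c : K, v.valuation (algebraMap K F c) ≤ 1 := fun c ↦
    v.toValuationSubring.valuation_le_one ⟨_, v.algebraMap_mem c⟩
  have key : v.valuation y ≤ max 1 (v.valuation x) :=
    valuation_le_max_of_eval₂_eq_zero' v.valuation hK hm hdeg
      (eval₂_aeval_algebraMap_X_eq_zero hΦ)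
  by_cases hvx : v.valuation x ≤ 1
  · rw [max_eq_left hvx] at key
    have hyO : y ∈ v.toValuationSubring := (v.toValuationSubring.valuation_le_one_iff y).1 key
    rw [v.mem_toValuationSubring_iff_ord_nonneg hy0] at hyO
    have : 0 ≤ max (-v.ord x) 0 := le_max_right _ _
    omega
  · rw [not_le] at hvx
    rw [max_eq_right hvx.le] at key
    have hyx : y / x ∈ v.toValuationSubring := by
      rw [← v.toValuationSubring.valuation_le_one_iff, map_div₀]
      exact div_le_one_of_le₀ key zero_le
    rw [v.mem_toValuationSubring_iff_ord_nonneg (div_ne_zero hy0 hx0), v.ord_div hy0 hx0] at hyx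
    have hordx : v.ord x < 0 := (v.one_lt_valuation_iff_ord_neg hx0).1 hvx
    have : max (-v.ord x) 0 = -v.ord x := max_eq_left (by omega)
    omega

end Corrected

end Literature.NumberTheory.DiophantineGeometry.AlgFunctionField
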